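import Summits.BirchSwinnertonDyer.BirchSwinnertonDyer.Theorems.PrintCf2SplitBadTwoCMShaEigenMiddleFactorSel
import Summits.BirchSwinnertonDyer.BirchSwinnertonDyer.Theorems.PrintCf2SplitBadTwoCMShaDescentSquare
import Summits.BirchSwinnertonDyer.BirchSwinnertonDyer.Theorems.PrintCf2SplitBadTwoRestrictedSelmerBottomValueOfFactors
import Summits.BirchSwinnertonDyer.BirchSwinnertonDyer.Theorems.PrintCf2SplitBadTwoCMPrimaryConjugationTransport
import HarnessLib

/-!
# Crux `PrintCf2.SplitBadTwoRankOneOfFacts` (item stmt-BirchSwinnertonDyer-20368), road α, S3c: (F2) and (R-BV) FROM THE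
# SELMER-LEVEL CM INPUT (H1-Sel) — the frame forms of p672681

Cell `bsd-print-cf2`, width seat `bsd-line-cf2-p1-w8` g2 (brick **B6h**, frame assembly); `--supports stmt-BirchSwinnertonDyer-20368` (helper,
Theses-free). HONEST FRAMING: nothing here closes a crux or a stub; BSD is not proved by any of this; no summit statement is proved by this
seat. No definition, no named fact, no `sorry`. beyond-print theorem: no.

* `natCard_trueSelmer_quotient_eq_sha_of_frame_of_sel`, `padicValNat_trueSelmer_quotient_eq_sha_of_frame_of_sel` — hF2's inner statement
  of `rBV_of_three_factor_values` on every S3c₂ frame ⟸ (H1-Sel) at `v` («the `E[𝔮_r^∞]`-component of every SELMER class dies on `D_v`»);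
* `rBV_of_factor_values_of_sel` — LEAD g12's (R-BV) VERBATIM ⟸ (F1) ∧ (F3) ∧ (H2) ∧ (H1-Sel);
(H1-Sel) ⟸ (H1″) ⟸ (H1-pts) (`CMPrimes.sel_input_of_H1`, p670747), and (H1-Sel) is the natural output of -w3 g9's dichotomy-and-exclusion
route (`KummerBranchDichotomy`) run on `Q = res_⊤(Sel_{2^∞}(E_K/K))` — a purely GLOBAL way to the CM input, alternative to the formal group.

References: A. Agboola, Compositio 143 (2007) §6, §8 [Agboola2007]; R. Greenberg, LNM 1716 (1999) §2–§4 [GreenbergLNM1716]; K. Rubin,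
LNM 1716 (1999) §2 [Rubin1999].
-/

noncomputable section

open scoped Classical

set_option linter.dupNamespace false
set_option autoImplicit false

open NumberField IsDedekindDomain Field
open Literature.NumberTheory.EllipticCurves Literature.NumberTheory.EllipticCurves.GreenbergSelmer
open Literature.NumberTheory.EllipticCurves.Castella2018.AcSelmer
open Literature.NumberTheory.EllipticCurves.Agboola2007
open Literature.NumberTheory.EllipticCurves.ResKernel
open Literature.NumberTheory.GaloisRepresentations
open Summit.BirchSwinnertonDyer.BirchSwinnertonDyer.Theorems.PrintCf2.RestrictedSelmerPair
open Summit.BirchSwinnertonDyer.BirchSwinnertonDyer.Theorems.PrintCf2.AdditiveAtSeven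

namespace Summit.BirchSwinnertonDyer.BirchSwinnertonDyer.Theorems.PrintCf2.CMPrimes

variable {K : Type} [Field K] [NumberField K]

/-- **Factor (F2) on the frame ⟸ (H1-Sel), `Nat.card` form**: `#((𝔖_v(K, E[𝔮_r^∞]) ⊓ L_M) ⧸ Q_M) = #Ш(W/ℚ)[2^∞]` on every S3c₂ frame, GRANTED
that the `E[𝔮_r^∞]`-component of every Selmer class dies on `D_v`. [cite: Agboola2007, Props. 6.10–6.11 (arXiv p0014:L1–p0015:L12)]
[cite: GrossLMS1991, §5 (5.1)] -/
theorem natCard_trueSelmer_quotient_eq_sha_of_frame_of_sel {d : ℤ} (hd0 : d ≠ 0) (W : WeierstrassCurve ℚ) [W.IsElliptic]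
    (C : WeierstrassCurve.VariableChange ℚ) (hCW : C • W = cm7.quadraticTwist (d : ℚ)) (hK : IsImaginaryQuadratic K)
    (v vbar : HeightOneSpectrum (𝓞 K)) (hv : ((2 : ℕ) : 𝓞 K) ∈ v.asIdeal) (hvbar : ((2 : ℕ) : 𝓞 K) ∈ vbar.asIdeal) (hne : vbar ≠ v)
    (π : (W.baseChange K).endRing) (hrel : (π : AddMonoid.End (W.baseChange K).geomPoints) * π = π - 2)
    {r : ℤ_[2]} (hr : r * r = r - 2)
    (hSel : ∀ y₀ ∈ (W.baseChange K).selmerGroupPInfty 2,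
      ∀ (c : subgroupH1 (⊤ : Subgroup (absoluteGaloisGroup K)) ↥((W.baseChange K).endEigenPrimaryTorsion 2 π r))
        (c' : subgroupH1 (⊤ : Subgroup (absoluteGaloisGroup K)) ↥((W.baseChange K).endEigenPrimaryTorsion 2 π (1 - r))),
        resH1Hom (ContinuousMonoidHom.id _) ((W.baseChange K).endEigenPrimaryTorsion 2 π r).subtype (fun _ _ ↦ rfl) c +
            resH1Hom (ContinuousMonoidHom.id _) ((W.baseChange K).endEigenPrimaryTorsion 2 π (1 - r)).subtype (fun _ _ ↦ rfl) c' =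
          resSubgroup (⊤ : Subgroup (absoluteGaloisGroup K)) ((W.baseChange K).geomPrimaryTorsion 2) y₀ →
        Literature.NumberTheory.EllipticCurves.resOfLe ↥((W.baseChange K).endEigenPrimaryTorsion 2 π r)
          (inf_le_left : ⊤ ⊓ decomp v ≤ ⊤) c = 0) :
    Nat.card (↥(restrictedSelmerBase ↥((W.baseChange K).endEigenPrimaryTorsion 2 π r) 2 v ⊓
            (((W.baseChange K).localKerOver 2 ⊤ (vbar.adicCompletion K)).comap
          (resH1Hom (ContinuousMonoidHom.id _) ((W.baseChange K).endEigenPrimaryTorsion 2 π r).subtype (fun _ _ ↦ rfl)))) ⧸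
          (((((W.baseChange K).kummerMapPInfty 2 (W.baseChange K).zsmul_geomPoints_surjective_holds).range).map
            (resSubgroup ⊤ ((W.baseChange K).geomPrimaryTorsion 2))).comap
          (resH1Hom (ContinuousMonoidHom.id _) ((W.baseChange K).endEigenPrimaryTorsion 2 π r).subtype (fun _ _ ↦ rfl))).addSubgroupOf
            (restrictedSelmerBase ↥((W.baseChange K).endEigenPrimaryTorsion 2 π r) 2 v ⊓
              (((W.baseChange K).localKerOver 2 ⊤ (vbar.adicCompletion K)).comap
          (resH1Hom (ContinuousMonoidHom.id _) ((W.baseChange K).endEigenPrimaryTorsion 2 π r).subtype (fun _ _ ↦ rfl))))) =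
      Nat.card (AddCommGroup.primaryComponent W.sha 2) := by
  -- the frame's supplies
  have hπg : (π : AddMonoid.End (W.baseChange K).geomPoints) ∈ (W.baseChange K).geomEndRing :=
    (W.baseChange K).endRing_le_geomEndRing π.2
  have hπG : ∀ (g : absoluteGaloisGroup K) (P : (W.baseChange K).geomPoints),
      (π : AddMonoid.End (W.baseChange K).geomPoints) (g • P) = g • (π : AddMonoid.End (W.baseChange K).geomPoints) P :=
    ((W.baseChange K).mem_equivariantSubring_iff _).mp (Subring.mem_inf.mp π.2).2
  obtain ⟨φ, hφ, hrelφ⟩ := exists_isogeny_apply_eq_cmEndo (W.baseChange K) hπg hπG hrel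
  obtain ⟨hinf, hsup⟩ := endEigenPrimaryTorsion_compl_of_frame hd0 W C hCW K π hrel hr
  have hunit : IsUnit (r - (1 - r)) := (two_dvd_or_two_dvd_one_sub_of_root hr).2
  have hall : ∀ w : HeightOneSpectrum (𝓞 K), ((2 : ℕ) : 𝓞 K) ∈ w.asIdeal → w = v ∨ w = vbar :=
    fun w hw ↦ eq_or_eq_of_two_mem K hK.1 hv hvbar hne hw
  obtain ⟨θ, hθ⟩ := exists_sq_eq_neg_seven_of_frame_cmEndo hd0 W C hCW π hrel
  have hj : W.j = -3375 := j_eq_of_smul_eq_cm7Twist hd0 W C hCW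
  -- THE `r`-eigen subgroup of `Ш(E_K/K)[2^∞]` and its partner
  obtain ⟨πM, hπM, -⟩ := exists_shaPi_two (W.baseChange K) φ hrelφ
  obtain ⟨C₁, hC₁⟩ := exists_addSubgroup_eigen (p := 2) exists_two_pow_smul_eq_zero_primaryComponent πM r
  obtain ⟨C₂, hC₂⟩ := exists_addSubgroup_eigen (p := 2) exists_two_pow_smul_eq_zero_primaryComponent πM (1 - r)
  have hcoe : ∀ (x : ↥(AddCommGroup.primaryComponent (W.baseChange K).sha 2)) (N : ℤ), πM x = N • x ↔
      galH1Map φ.toAddMonoidHom φ.equivariant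
          (((x : ↥(AddCommGroup.primaryComponent (W.baseChange K).sha 2)) : (W.baseChange K).sha) : (W.baseChange K).galH1) =
        N • (((x : ↥(AddCommGroup.primaryComponent (W.baseChange K).sha 2)) : (W.baseChange K).sha) : (W.baseChange K).galH1) :=
    fun x N ↦ by
    rw [← hπM x]
    constructor
    · intro h; rw [h, AddSubgroupClass.coe_zsmul, AddSubgroupClass.coe_zsmul]
    · intro h
      apply Subtype.ext; apply Subtype.ext
      rw [h, AddSubgroupClass.coe_zsmul, AddSubgroupClass.coe_zsmul]
  have hC : ∀ x : ↥(AddCommGroup.primaryComponent (W.baseChange K).sha 2), x ∈ C₁ ↔ ∀ (k : ℕ) (N : ℤ), 2 ^ k • x = 0 →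
      ((N : ℤ_[2]) - r) ∈ (Ideal.span {(2 : ℤ_[2]) ^ k} : Ideal ℤ_[2]) →
        galH1Map φ.toAddMonoidHom φ.equivariant
            (((x : ↥(AddCommGroup.primaryComponent (W.baseChange K).sha 2)) : (W.baseChange K).sha) : (W.baseChange K).galH1) =
          N • (((x : ↥(AddCommGroup.primaryComponent (W.baseChange K).sha 2)) : (W.baseChange K).sha) : (W.baseChange K).galH1) :=
    fun x ↦ by
    rw [hC₁ x]
    exact forall_congr' fun k ↦ forall_congr' fun N ↦ forall_congr' fun _ ↦ forall_congr' fun _ ↦ hcoe x N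
  have hC' : ∀ x : ↥(AddCommGroup.primaryComponent (W.baseChange K).sha 2), x ∈ C₂ ↔ ∀ (k : ℕ) (N : ℤ), 2 ^ k • x = 0 →
      ((N : ℤ_[2]) - (1 - r)) ∈ (Ideal.span {(2 : ℤ_[2]) ^ k} : Ideal ℤ_[2]) →
        galH1Map φ.toAddMonoidHom φ.equivariant
            (((x : ↥(AddCommGroup.primaryComponent (W.baseChange K).sha 2)) : (W.baseChange K).sha) : (W.baseChange K).galH1) =
          N • (((x : ↥(AddCommGroup.primaryComponent (W.baseChange K).sha 2)) : (W.baseChange K).sha) : (W.baseChange K).galH1) :=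
    fun x ↦ by
    rw [hC₂ x]
    exact forall_congr' fun k ↦ forall_congr' fun N ↦ forall_congr' fun _ ↦ forall_congr' fun _ ↦ hcoe x N
  -- the three counts
  have h1 := (natCard_trueSelmer_quotient_eq_natCard_range_shaMap (W.baseChange K) 2 π r v vbar hK hall).1
  have h2 := natCard_range_shaBridge_trueSelmer_eq_of_sel (W.baseChange K) 2 π r v vbar hK hall hinf hsup hunit φ hφ hSel hC
  have h3 := (natCard_cmPrimary_sha_eq_of_isogeny W hj hK hθ φ hrelφ hr hC hC').1
  exact h1.trans (h2.trans h3)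

/-- **Factor (F2) on the frame ⟸ (H1-Sel), `v₂` form** — hF2's inner statement of `rBV_of_three_factor_values`, VERBATIM.
[cite: Agboola2007, Props. 6.10–6.11 (arXiv p0014:L1–p0015:L12)] [cite: GrossLMS1991, §5 (5.1)] -/
theorem padicValNat_trueSelmer_quotient_eq_sha_of_frame_of_sel {d : ℤ} (hd0 : d ≠ 0) (W : WeierstrassCurve ℚ) [W.IsElliptic]
    (C : WeierstrassCurve.VariableChange ℚ) (hCW : C • W = cm7.quadraticTwist (d : ℚ)) (hK : IsImaginaryQuadratic K)
    (v vbar : HeightOneSpectrum (𝓞 K)) (hv : ((2 : ℕ) : 𝓞 K) ∈ v.asIdeal) (hvbar : ((2 : ℕ) : 𝓞 K) ∈ vbar.asIdeal) (hne : vbar ≠ v)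
    (π : (W.baseChange K).endRing) (hrel : (π : AddMonoid.End (W.baseChange K).geomPoints) * π = π - 2)
    {r : ℤ_[2]} (hr : r * r = r - 2)
    (hSel : ∀ y₀ ∈ (W.baseChange K).selmerGroupPInfty 2,
      ∀ (c : subgroupH1 (⊤ : Subgroup (absoluteGaloisGroup K)) ↥((W.baseChange K).endEigenPrimaryTorsion 2 π r))
        (c' : subgroupH1 (⊤ : Subgroup (absoluteGaloisGroup K)) ↥((W.baseChange K).endEigenPrimaryTorsion 2 π (1 - r))),
        resH1Hom (ContinuousMonoidHom.id _) ((W.baseChange K).endEigenPrimaryTorsion 2 π r).subtype (fun _ _ ↦ rfl) c +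
            resH1Hom (ContinuousMonoidHom.id _) ((W.baseChange K).endEigenPrimaryTorsion 2 π (1 - r)).subtype (fun _ _ ↦ rfl) c' =
          resSubgroup (⊤ : Subgroup (absoluteGaloisGroup K)) ((W.baseChange K).geomPrimaryTorsion 2) y₀ →
        Literature.NumberTheory.EllipticCurves.resOfLe ↥((W.baseChange K).endEigenPrimaryTorsion 2 π r)
          (inf_le_left : ⊤ ⊓ decomp v ≤ ⊤) c = 0) :
    padicValNat 2 (Nat.card (↥(restrictedSelmerBase ↥((W.baseChange K).endEigenPrimaryTorsion 2 π r) 2 v ⊓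
            (((W.baseChange K).localKerOver 2 ⊤ (vbar.adicCompletion K)).comap
          (resH1Hom (ContinuousMonoidHom.id _) ((W.baseChange K).endEigenPrimaryTorsion 2 π r).subtype (fun _ _ ↦ rfl)))) ⧸
          (((((W.baseChange K).kummerMapPInfty 2 (W.baseChange K).zsmul_geomPoints_surjective_holds).range).map
            (resSubgroup ⊤ ((W.baseChange K).geomPrimaryTorsion 2))).comap
          (resH1Hom (ContinuousMonoidHom.id _) ((W.baseChange K).endEigenPrimaryTorsion 2 π r).subtype (fun _ _ ↦ rfl))).addSubgroupOf
            (restrictedSelmerBase ↥((W.baseChange K).endEigenPrimaryTorsion 2 π r) 2 v ⊓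
              (((W.baseChange K).localKerOver 2 ⊤ (vbar.adicCompletion K)).comap
          (resH1Hom (ContinuousMonoidHom.id _) ((W.baseChange K).endEigenPrimaryTorsion 2 π r).subtype (fun _ _ ↦ rfl)))))) =
      padicValNat 2 (Nat.card (AddCommGroup.primaryComponent W.sha 2)) := by
  rw [natCard_trueSelmer_quotient_eq_sha_of_frame_of_sel hd0 W C hCW hK v vbar hv hvbar hne π hrel hr hSel]

/-- **(R-BV) OF LEAD g12, VERBATIM, from (F1), (F3), (H2) and the Selmer-level CM input (H1-Sel) at `v`** (-w7 g2's
`rBV_of_three_factor_values` with (F2) by `padicValNat_trueSelmer_quotient_eq_sha_of_frame_of_sel` and (H1′) by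
`comap_kummer_le_ker_resOfLe_of_sel`). [cite: Agboola2007, Props. 6.10, 6.11, 8.1 (arXiv p0014–p0017)] [cite: GreenbergLNM1716, §2] -/
theorem rBV_of_factor_values_of_sel
    (hF1 : ∃ e₁ : ℤ → ℤ → ℤ, ∀ (d : ℤ), d ≠ 0 → Squarefree d → d % 4 ≠ 1 →
      ∀ (W : WeierstrassCurve ℚ) [W.IsElliptic] [W.IsGloballyMinimal] (C : WeierstrassCurve.VariableChange ℚ),
        C • W = cm7.quadraticTwist (d : ℚ) → W.analyticRank = 1 →
      ∀ (K : Type) [Field K] [NumberField K], IsImaginaryQuadratic K →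
      ∀ (v vbar : HeightOneSpectrum (𝓞 K)),
        ((2 : ℕ) : 𝓞 K) ∈ v.asIdeal → ((2 : ℕ) : 𝓞 K) ∈ vbar.asIdeal → vbar ≠ v →
      ∀ (π : (W.baseChange K).endRing), (π : AddMonoid.End (W.baseChange K).geomPoints) * π = π - 2 →
      ∀ (r : ℤ_[2]), r * r = r - 2 →
        (∀ τ ∈ GreenbergSelmer.inertia v, ∀ x : ↥((W.baseChange K).endEigenPrimaryTorsion 2 π r), τ • x = x ∨ τ • x = -x) →
      ∀ (P : W.toAffine.Point) (c₀ : ℕ) (ℓ : ℤ),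
        ¬ IsOfFinAddOrder P →
        (∀ R : W.toAffine.Point, ∃ (k : ℤ) (T : W.toAffine.Point), IsOfFinAddOrder T ∧ R = k • P + T) →
        c₀ ≠ 0 → (W.baseChange ℚ_[2]).IsInReductionKernel (c₀ • W.toPadicPoint 2 P) →
        ‖(W.baseChange ℚ_[2]).padicLogPoint (c₀ • W.toPadicPoint 2 P) / (c₀ : ℚ_[2])‖ = (2 : ℝ) ^ (-ℓ) →
      Finite (restrictedSelmerBase ↥((W.baseChange K).endEigenPrimaryTorsion 2 π r) 2 vbar) →
        (padicValNat 2 (Nat.card ↥(((((W.baseChange K).kummerMapPInfty 2 (W.baseChange K).zsmul_geomPoints_surjective_holds).range).map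
            (resSubgroup ⊤ ((W.baseChange K).geomPrimaryTorsion 2))).comap
          (resH1Hom (ContinuousMonoidHom.id _) ((W.baseChange K).endEigenPrimaryTorsion 2 π r).subtype (fun _ _ ↦ rfl)) ⊓
          (resOfLe ↥((W.baseChange K).endEigenPrimaryTorsion 2 π r) (inf_le_left : ⊤ ⊓ decomp vbar ≤ ⊤)).ker)) : ℤ) = ℓ + e₁ (d % 2) ((d / (2 - d % 2)) % 8))
    (hF3 : ∃ e₃ : ℤ → ℤ → ℤ, ∀ (d : ℤ), d ≠ 0 → Squarefree d → d % 4 ≠ 1 →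
      ∀ (W : WeierstrassCurve ℚ) [W.IsElliptic] [W.IsGloballyMinimal] (C : WeierstrassCurve.VariableChange ℚ),
        C • W = cm7.quadraticTwist (d : ℚ) → W.analyticRank = 1 →
      ∀ (K : Type) [Field K] [NumberField K], IsImaginaryQuadratic K →
      ∀ (v vbar : HeightOneSpectrum (𝓞 K)),
        ((2 : ℕ) : 𝓞 K) ∈ v.asIdeal → ((2 : ℕ) : 𝓞 K) ∈ vbar.asIdeal → vbar ≠ v →
      ∀ (π : (W.baseChange K).endRing), (π : AddMonoid.End (W.baseChange K).geomPoints) * π = π - 2 →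
      ∀ (r : ℤ_[2]), r * r = r - 2 →
        (∀ τ ∈ GreenbergSelmer.inertia v, ∀ x : ↥((W.baseChange K).endEigenPrimaryTorsion 2 π r), τ • x = x ∨ τ • x = -x) →
      ∀ (P : W.toAffine.Point) (c₀ : ℕ) (ℓ : ℤ),
        ¬ IsOfFinAddOrder P →
        (∀ R : W.toAffine.Point, ∃ (k : ℤ) (T : W.toAffine.Point), IsOfFinAddOrder T ∧ R = k • P + T) →
        c₀ ≠ 0 → (W.baseChange ℚ_[2]).IsInReductionKernel (c₀ • W.toPadicPoint 2 P) →
        ‖(W.baseChange ℚ_[2]).padicLogPoint (c₀ • W.toPadicPoint 2 P) / (c₀ : ℚ_[2])‖ = (2 : ℝ) ^ (-ℓ) →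
      Finite (restrictedSelmerBase ↥((W.baseChange K).endEigenPrimaryTorsion 2 π r) 2 vbar) →
        (padicValNat 2 (Nat.card ((resOfLe ↥((W.baseChange K).endEigenPrimaryTorsion 2 π r) (inf_le_left : ⊤ ⊓ decomp v ≤ ⊤)).comp
          (restrictedSelmerBase ↥((W.baseChange K).endEigenPrimaryTorsion 2 π r) 2 vbar).subtype).range) : ℤ) = ℓ + e₃ (d % 2) ((d / (2 - d % 2)) % 8))
    (hH2 : ∀ (d : ℤ), d ≠ 0 → Squarefree d → d % 4 ≠ 1 →
      ∀ (W : WeierstrassCurve ℚ) [W.IsElliptic] [W.IsGloballyMinimal] (C : WeierstrassCurve.VariableChange ℚ),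
        C • W = cm7.quadraticTwist (d : ℚ) → W.analyticRank = 1 →
      ∀ (K : Type) [Field K] [NumberField K], IsImaginaryQuadratic K →
      ∀ (v vbar : HeightOneSpectrum (𝓞 K)),
        ((2 : ℕ) : 𝓞 K) ∈ v.asIdeal → ((2 : ℕ) : 𝓞 K) ∈ vbar.asIdeal → vbar ≠ v →
      ∀ (π : (W.baseChange K).endRing), (π : AddMonoid.End (W.baseChange K).geomPoints) * π = π - 2 →
      ∀ (r : ℤ_[2]), r * r = r - 2 →
        (∀ τ ∈ GreenbergSelmer.inertia v, ∀ x : ↥((W.baseChange K).endEigenPrimaryTorsion 2 π r), τ • x = x ∨ τ • x = -x) →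
      ∀ (P : W.toAffine.Point) (c₀ : ℕ) (ℓ : ℤ),
        ¬ IsOfFinAddOrder P →
        (∀ R : W.toAffine.Point, ∃ (k : ℤ) (T : W.toAffine.Point), IsOfFinAddOrder T ∧ R = k • P + T) →
        c₀ ≠ 0 → (W.baseChange ℚ_[2]).IsInReductionKernel (c₀ • W.toPadicPoint 2 P) →
        ‖(W.baseChange ℚ_[2]).padicLogPoint (c₀ • W.toPadicPoint 2 P) / (c₀ : ℚ_[2])‖ = (2 : ℝ) ^ (-ℓ) →
      Finite (restrictedSelmerBase ↥((W.baseChange K).endEigenPrimaryTorsion 2 π r) 2 vbar) →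
        (restrictedSelmerBase ↥((W.baseChange K).endEigenPrimaryTorsion 2 π r) 2 v ⊓
            (((W.baseChange K).localKerOver 2 ⊤ (vbar.adicCompletion K)).comap
          (resH1Hom (ContinuousMonoidHom.id _) ((W.baseChange K).endEigenPrimaryTorsion 2 π r).subtype (fun _ _ ↦ rfl)))).map
            (resOfLe ↥((W.baseChange K).endEigenPrimaryTorsion 2 π r) (inf_le_left : ⊤ ⊓ decomp vbar ≤ ⊤)) ≤
          (((((W.baseChange K).kummerMapPInfty 2 (W.baseChange K).zsmul_geomPoints_surjective_holds).range).map
            (resSubgroup ⊤ ((W.baseChange K).geomPrimaryTorsion 2))).comap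
          (resH1Hom (ContinuousMonoidHom.id _) ((W.baseChange K).endEigenPrimaryTorsion 2 π r).subtype (fun _ _ ↦ rfl))).map
            (resOfLe ↥((W.baseChange K).endEigenPrimaryTorsion 2 π r) (inf_le_left : ⊤ ⊓ decomp vbar ≤ ⊤)))
    (hSel : ∀ (d : ℤ), d ≠ 0 → Squarefree d → d % 4 ≠ 1 →
      ∀ (W : WeierstrassCurve ℚ) [W.IsElliptic] [W.IsGloballyMinimal] (C : WeierstrassCurve.VariableChange ℚ),
        C • W = cm7.quadraticTwist (d : ℚ) → W.analyticRank = 1 →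
      ∀ (K : Type) [Field K] [NumberField K], IsImaginaryQuadratic K →
      ∀ (v vbar : HeightOneSpectrum (𝓞 K)),
        ((2 : ℕ) : 𝓞 K) ∈ v.asIdeal → ((2 : ℕ) : 𝓞 K) ∈ vbar.asIdeal → vbar ≠ v →
      ∀ (π : (W.baseChange K).endRing), (π : AddMonoid.End (W.baseChange K).geomPoints) * π = π - 2 →
      ∀ (r : ℤ_[2]), r * r = r - 2 →
        (∀ τ ∈ GreenbergSelmer.inertia v, ∀ x : ↥((W.baseChange K).endEigenPrimaryTorsion 2 π r), τ • x = x ∨ τ • x = -x) →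
      ∀ (P : W.toAffine.Point) (c₀ : ℕ) (ℓ : ℤ),
        ¬ IsOfFinAddOrder P →
        (∀ R : W.toAffine.Point, ∃ (k : ℤ) (T : W.toAffine.Point), IsOfFinAddOrder T ∧ R = k • P + T) →
        c₀ ≠ 0 → (W.baseChange ℚ_[2]).IsInReductionKernel (c₀ • W.toPadicPoint 2 P) →
        ‖(W.baseChange ℚ_[2]).padicLogPoint (c₀ • W.toPadicPoint 2 P) / (c₀ : ℚ_[2])‖ = (2 : ℝ) ^ (-ℓ) →
      Finite (restrictedSelmerBase ↥((W.baseChange K).endEigenPrimaryTorsion 2 π r) 2 vbar) →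
        ∀ y₀ ∈ (W.baseChange K).selmerGroupPInfty 2,
          ∀ (c : subgroupH1 (⊤ : Subgroup (absoluteGaloisGroup K)) ↥((W.baseChange K).endEigenPrimaryTorsion 2 π r))
            (c' : subgroupH1 (⊤ : Subgroup (absoluteGaloisGroup K)) ↥((W.baseChange K).endEigenPrimaryTorsion 2 π (1 - r))),
            resH1Hom (ContinuousMonoidHom.id _) ((W.baseChange K).endEigenPrimaryTorsion 2 π r).subtype (fun _ _ ↦ rfl) c +
                resH1Hom (ContinuousMonoidHom.id _) ((W.baseChange K).endEigenPrimaryTorsion 2 π (1 - r)).subtype (fun _ _ ↦ rfl) c' =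
              resSubgroup (⊤ : Subgroup (absoluteGaloisGroup K)) ((W.baseChange K).geomPrimaryTorsion 2) y₀ →
            Literature.NumberTheory.EllipticCurves.resOfLe ↥((W.baseChange K).endEigenPrimaryTorsion 2 π r)
              (inf_le_left : ⊤ ⊓ decomp v ≤ ⊤) c = 0) :
    ∃ eK : ℤ → ℤ → ℤ, ∀ (d : ℤ), d ≠ 0 → Squarefree d → d % 4 ≠ 1 →
      ∀ (W : WeierstrassCurve ℚ) [W.IsElliptic] [W.IsGloballyMinimal] (C : WeierstrassCurve.VariableChange ℚ),
        C • W = cm7.quadraticTwist (d : ℚ) → W.analyticRank = 1 →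
      ∀ (K : Type) [Field K] [NumberField K], IsImaginaryQuadratic K →
      ∀ (v vbar : HeightOneSpectrum (𝓞 K)),
        ((2 : ℕ) : 𝓞 K) ∈ v.asIdeal → ((2 : ℕ) : 𝓞 K) ∈ vbar.asIdeal → vbar ≠ v →
      ∀ (π : (W.baseChange K).endRing), (π : AddMonoid.End (W.baseChange K).geomPoints) * π = π - 2 →
      ∀ (r : ℤ_[2]), r * r = r - 2 →
        (∀ τ ∈ GreenbergSelmer.inertia v, ∀ x : ↥((W.baseChange K).endEigenPrimaryTorsion 2 π r), τ • x = x ∨ τ • x = -x) →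
      ∀ (P : W.toAffine.Point) (c₀ : ℕ) (ℓ : ℤ),
        ¬ IsOfFinAddOrder P →
        (∀ R : W.toAffine.Point, ∃ (k : ℤ) (T : W.toAffine.Point), IsOfFinAddOrder T ∧ R = k • P + T) →
        c₀ ≠ 0 → (W.baseChange ℚ_[2]).IsInReductionKernel (c₀ • W.toPadicPoint 2 P) →
        ‖(W.baseChange ℚ_[2]).padicLogPoint (c₀ • W.toPadicPoint 2 P) / (c₀ : ℚ_[2])‖ = (2 : ℝ) ^ (-ℓ) →
      Finite (restrictedSelmerBase ↥((W.baseChange K).endEigenPrimaryTorsion 2 π r) 2 vbar) →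
        (padicValNat 2 (Nat.card (restrictedSelmerBase ↥((W.baseChange K).endEigenPrimaryTorsion 2 π r) 2 vbar)) : ℤ) =
          (padicValNat 2 (Nat.card (AddCommGroup.primaryComponent W.sha 2)) : ℤ) + 2 * ℓ + eK (d % 2) ((d / (2 - d % 2)) % 8) := by
  refine rBV_of_three_factor_values hF1 ?_ hF3 ?_ hH2
  · intro d hd0 hsq hd4 W _ _ C hC hrank K _ _ hK v vbar hv hvbar hne π hπ r hr hpin P c₀ ℓ hP hgen hc₀ hker hlog hfin
    exact padicValNat_trueSelmer_quotient_eq_sha_of_frame_of_sel hd0 W C hC hK v vbar hv hvbar hne π hπ hr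
      (hSel d hd0 hsq hd4 W C hC hrank K hK v vbar hv hvbar hne π hπ r hr hpin P c₀ ℓ hP hgen hc₀ hker hlog hfin)
  · intro d hd0 hsq hd4 W _ _ C hC hrank K _ _ hK v vbar hv hvbar hne π hπ r hr hpin P c₀ ℓ hP hgen hc₀ hker hlog hfin
    exact comap_kummer_le_ker_resOfLe_of_sel (W.baseChange K) 2 π r v
      (hSel d hd0 hsq hd4 W C hC hrank K hK v vbar hv hvbar hne π hπ r hr hpin P c₀ ℓ hP hgen hc₀ hker hlog hfin)

end Summit.BirchSwinnertonDyer.BirchSwinnertonDyer.Theorems.PrintCf2.CMPrimes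


end
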